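import Summits.QuantumAdvantage.QuantumAdvantage.Theses.LinnikCubicClassGroups
import Literature.Computability.QuantumComplexity.AdviceChain

/-!
# Crux `LinnikCubicClassGroups.PureCubicClassGroupFBQP` (stmt-QuantumAdvantage-11544) — stub `stub_adviceChain`

Line `arakelov-giant-step-cycle`, stub `stub_adviceChain` (S5b-P8): GENERIC quantum-complexity
plumbing, no number theory. A bounded-error quantum solver for a NUMERIC ADVICE relation (on a
well-formed query `q`, output `⟨bin r, t⟩` with `good q r`, the good values forming an interval)
and a main stage (`pre, post ∈ FP`, an oracle-free uniform Clifford+`T` family) which, fed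
`⟨w, bin r⟩` with good advice, reaches `Good₂ w` with probability `≥ 11/12`, compose into a
bounded-error quantum solver for `w ↦ {⟨o, t⟩ | Good₂ w o}`.

This file is the one-line application of the Literature theorem
`Literature.Computability.QuantumComplexity.AdviceChain.isQSolvable_of_numericAdvice`
(`Literature/Computability/QuantumComplexity/AdviceChain.lean`, with the stage family and the
bookkeeping in `AdviceChainStages.lean`): five runs of the advice solver composed by the sequential
chain combinator `SeqChain.family` (stage family = one classical wrap of the parity sum of the two
wrapped families, dispatching on the stage counter), the median of the five canonical answers
(good with probability `≥ Pr[Bin(5, 2/3) ≥ 3] = 192/243`, the count of good answers dominating a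
binomial law along the chain law; the median of a list with a good majority under an interval
condition is good), then the main stage: `(192/243)·(11/12) ≥ 2/3`.
-/

-- the problem namespace repeats the summit name (`QuantumAdvantage.QuantumAdvantage`)
set_option linter.dupNamespace false

namespace Summit.QuantumAdvantage.QuantumAdvantage.Theorems.LinnikCubicClassGroups

open Computability (encodeNat decodeNat)
open Literature.Computability.Cryptography (IsQSolvable QCircuitFamily cliffordT)
open Literature.Computability.Complexity (boolPair FP)

/-- **S5b-P8 `stub_adviceChain`.** A bounded-error quantum solver for a numeric advice relation
(on query `q`, output `⟨bin r, ·⟩` with `good q r`, the good `r` forming an interval) and a main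
stage that, fed `⟨w, bin r⟩` with good advice, reaches its goal with probability `≥ 11/12`,
compose into a bounded-error solver for the goal (five advice runs in a sequential chain of
stages, the median of the answers, one run of the main stage;
`AdviceChain.isQSolvable_of_numericAdvice`). [Bennett–Bernstein–Brassard–Vazirani 1997,
Thm. 4.13–4.14; Jerrum–Valiant–Vazirani 1986, Lemma 6.1; Nielsen–Chuang 2010, §4.4] -/
theorem stub_adviceChain :
    ∀ (WF : List Bool → Prop) (good : List Bool → ℕ → Prop) (qry : List Bool → List Bool)
      (WF₂ : List Bool → Prop) (Good₂ : List Bool → List Bool → Prop),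
      qry ∈ FP → (∀ w, WF₂ w → WF (qry w)) →
      (∀ (q : List Bool) (r₁ r₂ r : ℕ), good q r₁ → good q r₂ → r₁ ≤ r → r ≤ r₂ → good q r) →
      -- the advice relation is solvable in quantum polynomial time
      IsQSolvable (fun q => {y | WF q → ∃ (r : ℕ) (t : List Bool), y = boolPair (encodeNat r) t ∧ good q r}) →
      -- the main stage succeeds with probability ≥ 11/12 whenever its advice is good
      (∃ (pre post : List Bool → List Bool), pre ∈ FP ∧ post ∈ FP ∧
        ∃ F : QCircuitFamily cliffordT, F.IsOracleFree ∧ F.IsUniform ∧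
          ∀ (w : List Bool) (r : ℕ), WF₂ w → good (qry w) r →
            (11 : ℝ) / 12 ≤ F.kernelProb 0 (pre (boolPair w (encodeNat r)))
              {y | Good₂ w (post (boolPair (boolPair w (encodeNat r)) y))}) →
      IsQSolvable (fun w => {z | WF₂ w → ∃ (o t : List Bool), z = boolPair o t ∧ Good₂ w o}) := by
  exact Literature.Computability.QuantumComplexity.AdviceChain.isQSolvable_of_numericAdvice

/-- **S5b-P8 `stub_adviceChainCore`** — the registered comment-free handle of `stub_adviceChain`
(the same statement, without the two inline comments of the skeleton text), proven verbatim
alongside it. -/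
theorem stub_adviceChainCore :
    ∀ (WF : List Bool → Prop) (good : List Bool → ℕ → Prop) (qry : List Bool → List Bool)
      (WF₂ : List Bool → Prop) (Good₂ : List Bool → List Bool → Prop),
      qry ∈ FP → (∀ w, WF₂ w → WF (qry w)) →
      (∀ (q : List Bool) (r₁ r₂ r : ℕ), good q r₁ → good q r₂ → r₁ ≤ r → r ≤ r₂ → good q r) →
      IsQSolvable (fun q => {y | WF q → ∃ (r : ℕ) (t : List Bool), y = boolPair (encodeNat r) t ∧ good q r}) →
      (∃ (pre post : List Bool → List Bool), pre ∈ FP ∧ post ∈ FP ∧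
        ∃ F : QCircuitFamily cliffordT, F.IsOracleFree ∧ F.IsUniform ∧
          ∀ (w : List Bool) (r : ℕ), WF₂ w → good (qry w) r →
            (11 : ℝ) / 12 ≤ F.kernelProb 0 (pre (boolPair w (encodeNat r)))
              {y | Good₂ w (post (boolPair (boolPair w (encodeNat r)) y))}) →
      IsQSolvable (fun w => {z | WF₂ w → ∃ (o t : List Bool), z = boolPair o t ∧ Good₂ w o}) := by
  exact stub_adviceChain

end Summit.QuantumAdvantage.QuantumAdvantage.Theorems.LinnikCubicClassGroups
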